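import Mathlib
import Summits.PneNP.PneNP.Theorems.CnfIdealGenLengthRankDefectRepresentationsBandCompletion
import Summits.PneNP.PneNP.Theorems.CnfIdealGenLengthRankDefectRepresentationsBandAveraging
import Summits.PneNP.PneNP.Theorems.CnfIdealGenLengthRankDefectRepresentationsDoubleMaxCutFour
import Summits.PneNP.PneNP.Theorems.CnfIdealGenLengthRankDefectRepresentationsCloseFour

/-!
# Crux `RankDefectRepresentations` (stmt-PneNP-18923), line `rank-dehn-ladder`: the registered lead stub `stub_merge` CLOSED (lead g16, RESHAPE 16)

MERGE with the ABSOLUTE constant `L₁ = 4` (`e = 0`): the two-family max-cut decomposition holds with constant 4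
(`…DoubleMaxCutFour.doubleMaxCut_four`, from the landed band completion X1 `…BandCompletion.stub_bandCompletion` and band averaging X2
`…BandAveraging.stub_bandAveraging`), and MERGE is its one-coordinate consequence (`…CloseFour.merge_of_four`, via `…MergeReduction.merge_of_doubleMaxCut`).
Also: `doubleMaxCut_four_holds` — the unconditional constant-4 decomposition, for importers.
HONEST FRAMING: this closes a registered TOOL stub of the negative lane (leads g9–g15's MERGE / CORE-LINEAR question); the item (RDR) stays open;
P ≠ NP is not moved; F-N2 is a FRONTIER formal rung.
-/

set_option linter.dupNamespace false -- `Summit.PneNP.PneNP.…`: summit = sub-problem name (D-0017)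

namespace Summit.PneNP.PneNP.Theorems.CnfIdealGenLengthRankDefectRepresentationsMergeFour

/-- **The two-family max-cut decomposition with the absolute constant 4**, unconditionally: every two-family instance all of whose double cuts have
four-rectangle rank `≤ c` decomposes as `S_I + S_J + L` with `rank L ≤ 4c`. -/
theorem doubleMaxCut_four_holds (K : Type) [Field K] (n n' : ℕ) :
    Summit.PneNP.PneNP.Theorems.CnfIdealGenLengthRankDefectRepresentationsTwoFamilyCutDomination.DoubleMaxCutDecomposition K n n' 4 :=
  Summit.PneNP.PneNP.Theorems.CnfIdealGenLengthRankDefectRepresentationsDoubleMaxCutFour.doubleMaxCut_four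
    Summit.PneNP.PneNP.Theorems.CnfIdealGenLengthRankDefectRepresentationsBandCompletion.stub_bandCompletion
    Summit.PneNP.PneNP.Theorems.CnfIdealGenLengthRankDefectRepresentationsBandAveraging.stub_bandAveraging n n'

/-- **Registered lead stub `stub_merge` of `Lines/rank_dehn_ladder.lean`** (verbatim signature), with `L₁ = 4`, `e = 0`. -/
theorem stub_merge :
    ∃ L₁ e : ℕ, ∀ (K : Type) [Field K] (n n' : ℕ),
      Summit.PneNP.PneNP.Theorems.CnfIdealGenLengthRankDefectRepresentationsMergeReduction.MergeBound K n n' (L₁ * (n + n' + 2) ^ e) :=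
  Summit.PneNP.PneNP.Theorems.CnfIdealGenLengthRankDefectRepresentationsCloseFour.merge_of_four
    (fun K _ n n' => doubleMaxCut_four_holds K n n')

end Summit.PneNP.PneNP.Theorems.CnfIdealGenLengthRankDefectRepresentationsMergeFour
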